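import Literature.IUT.LogThetaLattice.StripFrameOfKitsToy
import Literature.IUT.LogThetaLattice.BiCoresOfKitsRealifiedD
import Literature.IUT.HodgeArakelov.RealifiedDFunctorSmall
import Literature.AnabelianGeometry.AbsoluteAnabelian.MonoAnalyticNonarchModel
import HarnessLib

/-!
# Non-vacuity: a kit-level bi-coric datum `BiCoricKit` over the TOY kits, with [IUTchII] Cor 4.5 (ii)'s `D^⊩(−)` GENUINELY
# SHAPED — and [IUTchIII] Thm 1.5 (v) at the kit frame with no hypothesis left

NV-L6 wave (abc-iut cell, L6-lead §F v1.18p; plan/ADJUDICATION-SPEC §4(iii)), seat abc-iut-w4-d005, row «NV-L6 BiCoricKit (toy kit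
stack)». abc-iut-L6-t3's kit-level interface `BiCoricKit X` (`BiCoresOfKits.lean`, p418478: the [IUTchIII] Def 1.1 (iv)–(vi) /
Prop 1.2 (vi)–(ix) / Thm 1.5 (iii)–(v) data over abc-iut-L5-t4's kits) and its constructor `BiCoricData.ofKits` had NO inhabitant
in the tree; abc-iut-w4-d009 g2's real-frame theorem `thm15vSingleIso_ofKits_of_realifiedD` (`BiCoresOfKitsRealifiedD.lean`,
p418793, over this seat's bridge p417639) was therefore uninstantiated. S. Mochizuki, *Inter-universal Teichmüller theory
III*, kurims (May 2020), Thm 1.5 (iii)–(v) pp. 48–51; *II* (Dec 2020) Cor 4.5 (ii) p. 132, Cor 4.10 (v) pp. 160–161.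
Claim key `Mochizuki2012` DISPUTED (D-0012); [cite: Mochizuki2012, Thm 1.5 (v) p.50].

CONTENT (over abc-iut-L5-t4's toy kits `toyKit` / `MultKit.toy` / `FKit.toy` and abc-iut-L5-d4's `MonoLaws.toy` — one valuation,
ambient category `Model.Obj l`, the one-object `𝒟^⊢`-groupoid — and abc-iut-L6-t3's toy `TimesMuSide` / frame
`KitsToy.timesMuSide`, `KitsToy.frame` of `StripFrameOfKitsToy.lean`):
* `KitsToy.biCoricKit l hl` : `BiCoricKit (KitsToy.timesMuSide l hl)` — shells: the one-object groupoid, every orbit datum the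
  FULL poly-isomorphism (as in abc-iut-L6-t3's witness `mkBiCoric`); `F(*𝔇)` (`FofD`) = the `ℱ`-prime-strip with the SAME
  constituents (over the toy kit `ℱ ↦ 𝒟` is the identity), `FofD_D` an identity; `F^{⊢×μ}_△(−) := 𝟭`; and the [IUTchII]
  Cor 4.5 (ii) / Thm 1.5 (v) slot GENUINELY SHAPED: **`RFrob := RlfImage toyLines toyCoeff _`** (this seat's `RealifiedDFunctorSmall`,
  p419308: the small model of abc-iut-w4-d009 g2's `ℝ_{>0}`-TORSOR category `RlfData`, `Aut ≅ ℝ_{>0}` — NOT a rigid toy target),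
  **`realified := realifiedDSmall …`** (the lift of Cor 4.5 (ii)'s functor `realifiedD`), `realifiedKummer :=` the FULL
  poly-isomorphism (= the whole `ℝ_{>0}`-orbit of Cor 4.6 (ii), `rlfImage_full_map_eq_orbit`);
* `KitsToy.biCoricData l hl := BiCoricData.ofKits … (biCoricKit l hl)` : `BiCoricData (KitsToy.frame l hl)` — the FIRST
  inhabitant of this seat-lineage's [IUTchIII] §1 bi-core interface over an ASSEMBLED kit frame (`nonempty_biCoricData_frame`);
* **`KitsToy.thm15vSingleIso`** / **`KitsToy.realifiedRigidAt`**: abc-iut-w4-d009 g2's real-frame theorems INSTANTIATED with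
  `Φ₀ := 𝟭`, `U₀ := inducedFunctor _` (faithful), `η₀ := realifiedDSmallForgetIso` (an identity) — [IUTchIII] Thm 1.5 (v) «induce AN
  isomorphism» and the consumer hypothesis `RealifiedRigidAt` (FACT-LIST F-2067/F-2066) HOLD for `KitsToy.biCoricData` with NO
  hypothesis left.
HONEST LABEL: TOY kit stack (one valuation, collage-category models; «degenerate» in §4(iii) terms — a consistency / non-vacuity
witness for the kit-level interfaces and the real-frame rigidity chain, NOT genuine Hodge theaters). Nothing here asserts a
disputed claim or takes a side on [IUTchIII] Cor 3.12. No new Prop fact; no instance; defs are witness data only.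
-/

noncomputable section

namespace Literature.IUT.LogThetaLattice

open CategoryTheory
open Literature.IUT.HodgeTheaters Literature.IUT.HodgeTheaters.PMBaseKit Literature.IUT.HodgeArakelov
open Literature.AnabelianGeometry.AbsoluteAnabelian

namespace KitsToy

variable (l : ℕ) [Fact l.Prime] (hl : l ≠ 2)

/-- **IUTchII:Cor4.5(ii)** (kurims p. 132 l. 1–3 «a distinguished element `log^{‡D^⊢}(p_v) ∈ ℝ_{≥0}(‡D^⊢)_v`») the pointed real
lines of the toy `𝒟^⊢`-prime-strips: at the one valuation, `(ℝ, 1)` (abc-iut-L4-t3's `RLine.real`).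
[claim: Mochizuki2012, status: disputed] -/
def toyLines : (MultKit.toy l hl).DMono → (toyKit l hl).V → RLine.{0} := fun _ _ => RLine.real 1 one_ne_zero

/-- **IUTchI:Ex3.5(iii)** (kurims p. 86) the (positive) `ρ`-scalars of the toy collections of data: `1`.
[claim: Mochizuki2012, status: disputed] -/
def toyCoeff : (toyKit l hl).V → ℝ := fun _ => 1

/-- **IUTchI:Ex3.5(iii)** (kurims p. 86) the toy `ρ`-scalars are positive. [claim: Mochizuki2012, status: disputed] -/
theorem toyCoeff_pos : ∀ v, 0 < toyCoeff l hl v := fun _ => one_pos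

/-- **IUTchII:Rmk4.5.1(i)** (kurims p. 133 «the `F`-prime-strip naturally determined by `Ψ_cns(*D)`») over the toy kit: `F(*𝔇)` has
the SAME constituents as `*𝔇` (the toy `ℱ ↦ 𝒟` is the identity functor, model `ℱ_v` = model `𝒟_v`).
[claim: Mochizuki2012, status: disputed] -/
def fOfD : (toyKit l hl).DStrip ⥤ (FKit.toy l hl).FStrip where
  obj D := ⟨D.obj, D.isLocal⟩
  map φ := φ
  map_id _ := rfl
  map_comp _ _ := rfl

/-- **IUTchII:Rmk4.5.1(i)** (kurims p. 133) … and its associated `𝒟`-prime-strip is `*𝔇` again (abc-iut-L6-t7's `assocDFunctor`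
after `fOfD` is the identity). [claim: Mochizuki2012, status: disputed] -/
def fOfD_D : fOfD l hl ⋙ PrimeStripGroupoids.assocDFunctor (FKit.toy l hl) ≅ 𝟭 _ :=
  Iso.refl _

/-- **IUTchIII:Thm1.5(iii)–(v)** (kurims pp. 48–51) with **IUTchIII:Prop1.2(vi)–(ix)** (pp. 32–34): the TOY kit-level bi-coric datum —
shells and Frobenius-like strips on the one-object groupoid with FULL orbit data, `F(*𝔇)` = `fOfD`, `F^{⊢×μ}_△(−) := 𝟭`, and the
[IUTchII] Cor 4.5 (ii) slot the GENUINE torsor shape: `RFrob := RlfImage`, `realified := realifiedDSmall`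
(`RealifiedDFunctorSmall.lean`), Kummer datum := the full `ℝ_{>0}`-orbit. [claim: Mochizuki2012, status: disputed] -/
def biCoricKit : BiCoricKit (timesMuSide l hl) where
  Sh := (MultKit.toy l hl).DMono
  holShell := (Functor.const _).obj (SingleObj.star Unit)
  fxmShell := (Functor.const _).obj (SingleObj.star Unit)
  monoShell := (Functor.const _).obj (SingleObj.star Unit)
  monoFxm _ := PolyIso.full _ _
  monoFxm_nonempty _ := ⟨Iso.refl _, PolyIso.mem_full _⟩
  monoFxm_map _ _ _ := PolyIso.mem_full _
  monoFxmOfF _ := PolyIso.full _ _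
  monoFxmOfF_nonempty _ := ⟨Iso.refl _, PolyIso.mem_full _⟩
  monoFxmOfF_le _ := subset_rfl
  fxmHol _ := PolyIso.full _ _
  fxmHol_nonempty _ := ⟨Iso.refl _, PolyIso.mem_full _⟩
  FofD := fOfD l hl
  FofD_D := fOfD_D l hl
  fxmOfDv := 𝟭 _
  fxmOfDv_dv := Iso.refl _
  dvDelta := (Functor.const _).obj (SingleObj.star Unit)
  fxOfDsucc := (Functor.const _).obj (SingleObj.star Unit)
  fxOfDsucc_delta := NatIso.ofComponents (fun _ => Iso.refl _) (fun _ => rfl)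
  fxmDeltaHT := (Functor.const _).obj (SingleObj.star Unit)
  kummer := NatIso.ofComponents (fun _ => Iso.refl _) (fun _ => rfl)
  RFrob := RlfImage (toyLines l hl) (toyCoeff l hl) (toyCoeff_pos l hl)
  realified := realifiedDSmall (toyLines l hl) (toyCoeff l hl) (toyCoeff_pos l hl)
  realifiedHT := HTRep.toDFunctor ⋙ (Functor.const _).obj (SingleObj.star Unit) ⋙
    realifiedDSmall (toyLines l hl) (toyCoeff l hl) (toyCoeff_pos l hl)
  realifiedKummer _ := PolyIso.full _ _
  realifiedKummer_nonempty _ := ⟨Iso.refl _, PolyIso.mem_full _⟩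

/-- **IUTchIII:Thm1.5(iii)** (kurims p. 48) the kit-level bi-coric interface IS inhabited (toy kit stack).
[claim: Mochizuki2012, status: disputed] -/
theorem nonempty_biCoricKit : Nonempty (BiCoricKit (timesMuSide l hl)) := ⟨biCoricKit l hl⟩

/-- **IUTchIII:Thm1.5(iii)–(v)** (kurims pp. 48–51) the [IUTchIII] §1 bi-core interface `BiCoricData` INSTANTIATED over the assembled
toy kit frame `KitsToy.frame` by abc-iut-L6-t3's `BiCoricData.ofKits`. [claim: Mochizuki2012, status: disputed] -/
def biCoricData : BiCoricData (frame l hl) :=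
  BiCoricData.ofKits (FKit.MonoLaws.toy l hl) (FKit.isomFtoDBijective_toy l hl) (FKit.isomFmtoDmSurjective_toy l hl)
    (FKit.rlfOfIsStrip_toy l hl) (timesMuSide l hl) (biCoricKit l hl)

/-- **IUTchIII:Thm1.5(iii)** (kurims p. 48) `BiCoricData` over an ASSEMBLED kit frame is inhabited.
[claim: Mochizuki2012, status: disputed] -/
theorem nonempty_biCoricData_frame : Nonempty (BiCoricData (frame l hl)) := ⟨biCoricData l hl⟩

/-- **IUTchII:Cor4.10(v)** (kurims p. 161 l. 30–33) the toy `RFrob` is the GENUINE torsor shape — NOT rigid: the `D^⊩`-datum of the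
toy `𝒟^⊢`-prime-strip has a non-identity automorphism (dilation by `2`; `rlfImage_exists_ne_id`).
[claim: Mochizuki2012, status: disputed] -/
theorem biCoricKit_RFrob_not_rigid (A : (biCoricKit l hl).RFrob) : ∃ f : A ⟶ A, f ≠ 𝟙 A :=
  rlfImage_exists_ne_id (toyLines l hl) (toyCoeff l hl) (toyCoeff_pos l hl) A

/-- **IUTchIII:Thm1.5(v)** (kurims p. 50) «induce [cf. [IUTchII], Corollaries 4.5, (ii); 4.10, (v)] AN isomorphism of collections of
data» HOLDS for the toy kit frame's bi-coric datum — abc-iut-w4-d009 g2's `thm15vSingleIso_ofKits_of_realifiedD` instantiated with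
`Φ₀ := 𝟭`, `U₀ := inducedFunctor _`, `η₀ := realifiedDSmallForgetIso` (no hypothesis left; FACT-LIST F-2067 at this `B`).
[claim: Mochizuki2012, status: disputed] -/
theorem thm15vSingleIso : (biCoricData l hl).Thm15vSingleIso :=
  @thm15vSingleIso_ofKits_of_realifiedD _ _ _ _ (FKit.MonoLaws.toy l hl) (FKit.isomFtoDBijective_toy l hl)
    (FKit.isomFmtoDmSurjective_toy l hl) (FKit.rlfOfIsStrip_toy l hl) (timesMuSide l hl) (biCoricKit l hl) _ _ _
    (toyLines l hl) (toyCoeff l hl) (toyCoeff_pos l hl) (𝟭 _)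
    (inducedFunctor (fun X : (MultKit.toy l hl).DMono =>
      (realifiedD (toyLines l hl) (toyCoeff l hl) (toyCoeff_pos l hl)).obj X))
    (InducedCategory.faithful _)
    (realifiedDSmallForgetIso (toyLines l hl) (toyCoeff l hl) (toyCoeff_pos l hl) ≪≫ (Functor.leftUnitor _).symm)

/-- **IUTchII:Cor4.10(v)** (kurims p. 160) the consumer hypothesis `RealifiedRigidAt` (abc-iut-L6-t3; FACT-LIST F-2066) HOLDS at
every pair of `𝒟^⊢`-prime-strips of the toy kit frame (abc-iut-w4-d009 g2's `realifiedRigidAt_ofKits_of_realifiedD`, same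
instantiation). [claim: Mochizuki2012, status: disputed] -/
theorem realifiedRigidAt (A B : (frame l hl).Dv) : (biCoricData l hl).RealifiedRigidAt A B :=
  @realifiedRigidAt_ofKits_of_realifiedD _ _ _ _ (FKit.MonoLaws.toy l hl) (FKit.isomFtoDBijective_toy l hl)
    (FKit.isomFmtoDmSurjective_toy l hl) (FKit.rlfOfIsStrip_toy l hl) (timesMuSide l hl) (biCoricKit l hl) _ _ _
    (toyLines l hl) (toyCoeff l hl) (toyCoeff_pos l hl) (𝟭 _)
    (inducedFunctor (fun X : (MultKit.toy l hl).DMono =>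
      (realifiedD (toyLines l hl) (toyCoeff l hl) (toyCoeff_pos l hl)).obj X))
    (InducedCategory.faithful _)
    (realifiedDSmallForgetIso (toyLines l hl) (toyCoeff l hl) (toyCoeff_pos l hl) ≪≫ (Functor.leftUnitor _).symm) A B

end KitsToy

end Literature.IUT.LogThetaLattice

end
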